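import Summits.HubbardSuperconductivity.HubbardSuperconductivity.Theorems.KLProgrammeKLRegimeScaleZeroCovarianceOffSiteSpatialEnvelope
import Summits.HubbardSuperconductivity.HubbardSuperconductivity.Theorems.KLProgrammeKLRegimeScaleZeroTimeGridParseval

/-!
# Route `KLProgramme`, crux K3 — engine-flow child (stmt-HubbardSuperconductivity-20437), stub (C) at `n = 0`, located item #22a «(C)-SCALE0-PT2»,
# the FAR-SITE supplier, pieces (F-c)/(F-d): the time-ℓ² of an off-site covariance row from CERTIFIED MOMENTUM JETS, uniformly in β

Seat hubbard-kl-k3c5-p1 (g14; owner of #22a).  For a far site `z` (centred, `2‖z‖∞ ≤ L`, `z̄ ≠ 0`) the off-site grid covariance entry is, by D7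
(`gridCov_hubbardCovAboveCT_apply_eq_sum_freqTerm`), the trigonometric sum `A(z; j₁, j₀) = Σ_i e^{iω_i(τ_{j₁}−τ_{j₀})} c_i(z)` over the `2M` Matsubara
frequencies of the window.  This file bounds its TIME-ℓ² over the `4M` grid WITHOUT any time-decay estimate and WITHOUT the factorial-Cauchy tables:
* §1 `norm_freqTerm_le_of_jets` — p1 g20's per-frequency spatial decay with the momentum-jet bound kept as a HYPOTHESIS `‖Dⁿg_ω‖ ≤ J`
  (`…TorusPeriodisation.norm_torusFourierInv_uvSpatialSample_le_inv_pow_offSite`, not the `_tab` version): `‖F_L(ω)‖ ≤ (1/β)(J/πⁿ)(1+4ⁿSₙ)(1+‖z‖∞)⁻ⁿ`;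
* §2 `sum_inv_max_sq_matsubaraIdx_le` — `Σ_{i : MatsubaraIdx M} 1/max(|ω_i|,a)² ≤ β/a` (p1's `tsum_int_one_div_beta_mul_max_sq_le`);
* §3 **`sum_normSq_gridCov_offSite_le_of_jets`** — with a jet ENVELOPE `‖Dⁿg_{μ,ω}(y)‖ ≤ Jn/max(|ω|,a)²` (`a = klE0/2`; the far certificate's clause, one number
  `Jn` per `n`, certified kit-side by Taylor-model AD — FAR-SITES-NOTE-g14 §4): for every base point `p₀ = (j₀, x₀)`, every `x₁ ≠ x₀` and spin `σ`,
  `Σ_{j₁ : Fin 4M} ‖A(((j₁,x₁),σ),0)((p₀,σ),1))‖² ≤ (4M/β)·(Jn²/a³)·((1+4ⁿSₙ)/πⁿ)²·(1+‖z_c‖∞)^{−2n}` — β-, L-uniform, by the time-grid Parseval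
  (`…ScaleZeroTimeGridParseval.sum_norm_sq_matsubaraSum_eq`).
The far rows of the reader (`sunsetRows_of_certV3`'s input `hfar`) follow from §3 by `‖A₂‖ ≤ 16`, `‖A₃‖ = ‖A₁‖` and the lattice tail `Σ_{‖z‖∞>Rc}` (next file).

No definitions; nothing here asserts (C), any stub of 20437, K3 or superconductivity.
References: BGM 2006 §2.3 (2.17)–(2.20), §3 (3.2) [cite: BenfattoGiulianiMastropietro2006].
-/

noncomputable section

namespace Summit.HubbardSuperconductivity.HubbardSuperconductivity.Theorems.KLRegimeSplit

set_option linter.dupNamespace false -- summit = problem name (single-conjunct summit), D-0017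

open Literature.MathematicalPhysics.QuantumLattice Literature.Probability.LatticeModels Literature.Analysis.FunctionSpaces
open Summit.HubbardSuperconductivity.HubbardSuperconductivity.Theorems.DispersionFlow
open MeasureTheory Set Finset Complex UnitAddTorus Real GrassmannAlgebra Matrix
open scoped FourierTransform Nat ENNReal NNReal

variable {L M : ℕ} [NeZero L]

/-! ## §1 Per-frequency spatial decay from a momentum-jet hypothesis (no table) -/

/-- **Per-frequency off-site decay of the frequency term from the jets alone**: `0 < β`, `ω ≠ 0`, `n ≥ 4`, `‖Dⁿ g_ω(y)‖ ≤ J` for all `y`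
(`g_ω(y) = Ψ(1, klE0; e₀(2πy), ω)`), a CENTRED off-site `z` (`2‖z‖∞ ≤ L`, `z̄ ≠ 0`) and every real `Δτ`:
`‖F_L(ω)‖ ≤ (1/β)·(J/πⁿ)·(1+4ⁿSₙ)·(1+‖z‖∞)⁻ⁿ`. -/
theorem norm_freqTerm_le_of_jets {β : ℝ} (hβ : 0 < β) (μ : ℝ) {om : ℝ} (hom : om ≠ 0) (Δτ : ℝ) {n : ℕ} (hn : 2 * 2 ≤ n) {J : ℝ}
    (hJ : ∀ y : Momentum, ‖iteratedFDeriv ℝ n (fun y : Momentum => uvSymbolFn 1 klE0 (frameLevel μ 0 ((2 * π) • y)) om) y‖ ≤ J)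
    {z : Site 2} (hz : 2 * ‖z‖ ≤ L) (hz0 : Torus.proj L z ≠ 0) :
    ‖((1 / (β * (L : ℝ) ^ 2) : ℝ) : ℂ) ^ 2 * cexp (I * ((om * Δτ : ℝ) : ℂ)) *
        ∑ k, torusChar k (Torus.proj L z) * uvSymbolFn (β * (L : ℝ) ^ 2) klE0 (nambuXiCT L μ 0 k) om‖ ≤
      (1 / β) * ((J / Real.pi ^ n) * (1 + (4 : ℝ) ^ n * ∑' k : Site 2, ((1 + ‖k‖) ^ n)⁻¹) * ((1 + ‖z‖) ^ n)⁻¹) := by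
  rw [freqTerm_eq_torusFourierInv_one hβ, norm_mul, norm_mul, Complex.norm_real, Real.norm_of_nonneg (by positivity)]
  have hexp : ‖cexp (I * ((om * Δτ : ℝ) : ℂ))‖ = 1 := by rw [mul_comm, Complex.norm_exp_ofReal_mul_I]
  rw [hexp, mul_one]
  exact mul_le_mul_of_nonneg_left (norm_torusFourierInv_uvSpatialSample_le_inv_pow_offSite 1 μ 0 hom hn hJ hz hz0) (by positivity)

/-! ## §2 The window's frequency sum `Σ_i 1/max(|ω_i|,a)²` is `≤ β/a` -/

/-- **`Σ_{i : MatsubaraIdx M} 1/max(|ω_i|, a)² ≤ β/a`** for `0 < β`, `0 < a` (finite window below the full fermionic series, p1 g20 §6). -/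
theorem sum_inv_max_sq_matsubaraIdx_le {β a : ℝ} (hβ : 0 < β) (ha : 0 < a) (M : ℕ) :
    ∑ i : MatsubaraIdx M, 1 / max |matsubaraFreq β M i| a ^ 2 ≤ β / a := by
  obtain ⟨hs, hle⟩ := tsum_int_one_div_beta_mul_max_sq_le hβ ha
  have h1 : ∑ i : MatsubaraIdx M, 1 / max |matsubaraFreq β M i| a ^ 2 =
      β * ∑ n ∈ Finset.Ico (-(M : ℤ)) M, 1 / (β * max |(2 * n + 1) * π / β| a ^ 2) := by
    rw [sum_matsubaraIdx_freq_eq_sum_Ico β M (fun om => 1 / max |om| a ^ 2), Finset.mul_sum]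
    refine Finset.sum_congr rfl fun n _ => ?_
    have hm : 0 < max |(2 * (n : ℝ) + 1) * π / β| a := lt_max_of_lt_right ha
    field_simp
  rw [h1, div_eq_mul_one_div β a]
  refine mul_le_mul_of_nonneg_left ?_ hβ.le
  exact (hs.sum_le_tsum _ fun n _ => by positivity).trans hle

/-! ## §3 The time-ℓ² of an off-site row from a jet envelope, uniformly in β -/

/-- **TIME-ℓ² OF AN OFF-SITE COVARIANCE ROW FROM CERTIFIED JETS** (bare frame, `0 < β`, `1 ≤ M`, `n ≥ 4`, `a > 0`): if the momentum jets of the scale-0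
symbol obey the envelope `‖Dⁿ g_{μ,ω}(y)‖ ≤ Jn/max(|ω|, a)²` for every `ω ≠ 0`, then for every base point `p₀`, every site `x₁ ≠ x₀` and spin `σ`,
`Σ_{j₁ : Fin 4M} ‖A(((j₁,x₁),σ),0)((p₀,σ),1))‖² ≤ (4M/β)·(Jn²/a³)·((1+4ⁿSₙ)/πⁿ)²·(1+‖z_c‖∞)^{−2n}`, `z_c` the centred representative of `x₁ − x₀`. -/
theorem sum_normSq_gridCov_offSite_le_of_jets {β : ℝ} (hβ : 0 < β) (hM : 0 < M) (μ : ℝ) {n : ℕ} (hn : 2 * 2 ≤ n) {a Jn : ℝ} (ha : 0 < a)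
    (hJ : ∀ om : ℝ, om ≠ 0 → ∀ y : Momentum,
      ‖iteratedFDeriv ℝ n (fun y : Momentum => uvSymbolFn 1 klE0 (frameLevel μ 0 ((2 * π) • y)) om) y‖ ≤ Jn / max |om| a ^ 2)
    (p₀ : GridPoint L (2 * (2 * M))) {x₁ : TorusSite 2 L} (hx : x₁ ≠ p₀.2) (σ : Fin 2) :
    ∑ j₁ : Fin (2 * (2 * M)), ‖((hubbardGridSub L M β (2 * (2 * M))).transpose * hubbardCovAboveCT L M β μ 0 0 klE0 *
        hubbardGridSub L M β (2 * (2 * M))) (((j₁, x₁), σ), 0) ((p₀, σ), 1)‖ ^ 2 ≤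
      (((2 * (2 * M) : ℕ) : ℝ) / β) * ((Jn ^ 2 / a ^ 3) *
        ((1 + (4 : ℝ) ^ n * ∑' k : Site 2, ((1 + ‖k‖) ^ n)⁻¹) / Real.pi ^ n) ^ 2 *
          (((1 + ‖(fun j => ((x₁ - p₀.2) j).valMinAbs : Site 2)‖) ^ n)⁻¹) ^ 2) := by
  classical
  have hN : 0 < 2 * (2 * M) := by omega
  have hNr : (0 : ℝ) < ((2 * (2 * M) : ℕ) : ℝ) := by exact_mod_cast hN
  -- the centred representative
  set z : Site 2 := fun j => ((x₁ - p₀.2) j).valMinAbs with hzdef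
  obtain ⟨hproj, hzc⟩ := two_mul_norm_valMinAbs_le (L := L) (x₁ - p₀.2)
  have hz0 : Torus.proj L z ≠ 0 := by rw [hproj]; exact sub_ne_zero.2 hx
  set Kz : ℝ := (1 + (4 : ℝ) ^ n * ∑' k : Site 2, ((1 + ‖k‖) ^ n)⁻¹) / Real.pi ^ n * ((1 + ‖z‖) ^ n)⁻¹ with hKz
  have hS : 0 ≤ ∑' k : Site 2, ((1 + ‖k‖) ^ n)⁻¹ := tsum_nonneg fun k => by positivity
  have hKz0 : 0 ≤ Kz := by positivity
  -- the window coefficients `c_i`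
  set cc : MatsubaraIdx M → ℂ := fun i => ((1 / β : ℝ) : ℂ) * torusFourierInv (fun kv : TorusSite 2 L =>
      (fun y : Momentum => uvSymbolFn 1 klE0 (frameLevel μ 0 ((2 * π) • y)) (matsubaraFreq β M i))
        (WithLp.toLp 2 fun i => ((kv i).val : ℝ) / L)) (Torus.proj L z) with hcc
  -- D7: each entry is the trigonometric sum `Σ_i e^{iω_i(τ_{j₁} − τ_{j₀})} c_i`
  have hentry : ∀ j₁ : Fin (2 * (2 * M)), ((hubbardGridSub L M β (2 * (2 * M))).transpose * hubbardCovAboveCT L M β μ 0 0 klE0 *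
        hubbardGridSub L M β (2 * (2 * M))) (((j₁, x₁), σ), 0) ((p₀, σ), 1) =
      ∑ i : MatsubaraIdx M, cexp (I * ((matsubaraFreq β M i *
        (gridTime β (2 * (2 * M)) j₁ - gridTime β (2 * (2 * M)) p₀.1) : ℝ) : ℂ)) * cc i := by
    intro j₁
    rw [gridCov_hubbardCovAboveCT_apply_eq_sum_freqTerm hβ μ klE0 ((j₁, x₁) : GridPoint L (2 * (2 * M))) p₀ σ]
    refine Finset.sum_congr rfl fun i _ => ?_
    have hpr : Torus.proj L (fun j => ((((j₁, x₁) : GridPoint L (2 * (2 * M))).2 j).val : ℤ) - (p₀.2 j).val) = Torus.proj L z := by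
      rw [torusProj_valSub_eq_sub, hproj]
    rw [hpr, freqTerm_eq_torusFourierInv_one hβ]
    simp only [hcc]
    ring
  simp_rw [hentry]
  rw [sum_norm_sq_matsubaraSum_eq hβ cc p₀.1]
  -- each coefficient: `‖c_i‖ ≤ (1/β)·(Jn/max(|ω_i|,a)²)·Kz`
  have hω : ∀ i : MatsubaraIdx M, matsubaraFreq β M i ≠ 0 := fun i => by
    simp only [matsubaraFreq]
    have hodd : (2 * (matsubaraInt M i : ℝ) + 1) ≠ 0 := by
      have : (2 * (matsubaraInt M i : ℝ) + 1) = ((2 * matsubaraInt M i + 1 : ℤ) : ℝ) := by push_cast; ring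
      rw [this]; exact_mod_cast (by omega : (2 * matsubaraInt M i + 1 : ℤ) ≠ 0)
    exact div_ne_zero (mul_ne_zero Real.pi_ne_zero hodd) hβ.ne'
  have hci : ∀ i : MatsubaraIdx M, ‖cc i‖ ≤ (1 / β) * (Jn / max |matsubaraFreq β M i| a ^ 2 * Kz) := by
    intro i
    simp only [hcc]
    rw [norm_mul, Complex.norm_real, Real.norm_of_nonneg (by positivity)]
    refine mul_le_mul_of_nonneg_left ?_ (by positivity)
    have h := norm_torusFourierInv_uvSpatialSample_le_inv_pow_offSite 1 μ 0 (hω i) hn (hJ _ (hω i)) hzc hz0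
    refine h.trans (le_of_eq ?_)
    simp only [hKz]
    ring
  -- square and sum
  have hsq : ∀ i : MatsubaraIdx M, ‖cc i‖ ^ 2 ≤ (1 / β) ^ 2 * Kz ^ 2 * (Jn ^ 2 / a ^ 2) * (1 / max |matsubaraFreq β M i| a ^ 2) := by
    intro i
    have hm : a ≤ max |matsubaraFreq β M i| a := le_max_right _ _
    have hm0 : 0 < max |matsubaraFreq β M i| a := lt_of_lt_of_le ha hm
    have h1 := hci i
    have hJn : 0 ≤ Jn := by
      have := hJ _ (hω i) 0
      have hnn := (norm_nonneg _).trans this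
      have : 0 ≤ Jn / max |matsubaraFreq β M i| a ^ 2 := hnn
      by_contra hneg
      rw [not_le] at hneg
      have : Jn / max |matsubaraFreq β M i| a ^ 2 < 0 := div_neg_of_neg_of_pos hneg (by positivity)
      linarith
    calc ‖cc i‖ ^ 2 ≤ ((1 / β) * (Jn / max |matsubaraFreq β M i| a ^ 2 * Kz)) ^ 2 := pow_le_pow_left₀ (norm_nonneg _) h1 2
      _ = (1 / β) ^ 2 * Kz ^ 2 * (Jn ^ 2 / (max |matsubaraFreq β M i| a ^ 2)) * (1 / max |matsubaraFreq β M i| a ^ 2) := by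
          field_simp
      _ ≤ (1 / β) ^ 2 * Kz ^ 2 * (Jn ^ 2 / a ^ 2) * (1 / max |matsubaraFreq β M i| a ^ 2) := by
          gcongr
  calc ((2 * (2 * M) : ℕ) : ℝ) * ∑ i, ‖cc i‖ ^ 2
      ≤ ((2 * (2 * M) : ℕ) : ℝ) * ∑ i, (1 / β) ^ 2 * Kz ^ 2 * (Jn ^ 2 / a ^ 2) * (1 / max |matsubaraFreq β M i| a ^ 2) :=
        mul_le_mul_of_nonneg_left (Finset.sum_le_sum fun i _ => hsq i) hNr.le
    _ = ((2 * (2 * M) : ℕ) : ℝ) * ((1 / β) ^ 2 * Kz ^ 2 * (Jn ^ 2 / a ^ 2) * ∑ i, 1 / max |matsubaraFreq β M i| a ^ 2) := by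
        rw [← Finset.mul_sum]
    _ ≤ ((2 * (2 * M) : ℕ) : ℝ) * ((1 / β) ^ 2 * Kz ^ 2 * (Jn ^ 2 / a ^ 2) * (β / a)) :=
        mul_le_mul_of_nonneg_left (mul_le_mul_of_nonneg_left (sum_inv_max_sq_matsubaraIdx_le hβ ha M) (by positivity)) hNr.le
    _ = (((2 * (2 * M) : ℕ) : ℝ) / β) * ((Jn ^ 2 / a ^ 3) *
        ((1 + (4 : ℝ) ^ n * ∑' k : Site 2, ((1 + ‖k‖) ^ n)⁻¹) / Real.pi ^ n) ^ 2 * (((1 + ‖z‖) ^ n)⁻¹) ^ 2) := by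
        simp only [hKz]
        field_simp

end Summit.HubbardSuperconductivity.HubbardSuperconductivity.Theorems.KLRegimeSplit

end
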